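import Literature.MathematicalPhysics.QuantumFieldTheory.Balaban1983to89.B9RWSums346MixedFactorFromLegs

/-!
# `Balaban1983to89.B9RWSums346LetterL2FromMajorants` — T. Bałaban, *Propagators for lattice gauge theories in a background field*, Commun. Math. Phys. **99**
# (1985) 389–434 [Balaban1985BackgroundPropagators] (3.88)–(3.89) p. 409, (3.46) p. 398, p. 391 with [4] (2.39)–(2.44) pp. 229–230: THE DIRECTION LETTERS
# `P_{□,ν}`, `C_□` OF `K(h_□)` IN BLOCK-`L²` FROM THEIR SUP MAJORANTS, THE KERNEL ROWS ∕ COLUMNS AND THE LETTER TRANSPOSES (Schur) — the letter inputs of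
# `B9RWSums346MixedFactorFromLegs.factorsL2Mixed37Dir_of_letterL2_legs` DISCHARGED from what the N06 certificate already displays plus two transposes

statement-level skeleton of published theorems with citation tags; proofs where landed; nothing here is a claim about the Yang–Mills mass gap

THE PRINT.  [4] (2.39)–(2.44) pp. 229–230: `∇_U(h_□f) = h_□∇_Uf + P_□f`-type Leibniz rules whose coefficient operators are local (one lattice step) with
`|∂h_□| ≦ O(1)(MLʲη)⁻¹`, `|Δh_□| ≦ O(1)(MLʲη)⁻²` — the sizes `kP, kC` (rows) and `kPt, kCt` (columns of the transposes) of the lineage's `StaticOK`∕`Sizes`;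
p. 391: the adjoints are taken in the natural `L²` products; (3.46) p. 398 are `L²` block bounds.

WHAT IS PROVED (sorry-free; 0 `def`).
* §1 ★ `blockBd_letter_of_majorants` — THE SCHUR STEP FOR A LOCAL LETTER: an endomorphism `T` with a sup majorant `K ≧ 0` of range `ρ` whose `p`-weighted entries are
  `K(a,b)·(L^{j_b}η)^p ≦ 1_S(a)·k`, and whose transpose `T′` (`IsTransposePair T T′`) has a sup majorant `K′ ≧ 0` with `K′(a,b)·(L^{j_b}η)^p ≦ 1_S(b)·k′`, has the `L²`
  block bound `1_S(y)·(√(k·k′·L₀^{|p|})·e^{(αδ∕2+δ_L)ρ})·(L^{j_y}η)^{−p}·e^{−δ_L d(y,y′)}` for every `δ_L ≧ 0` (`B9RWSums346Schur.blockBd_schur`, then p. 398's scale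
  transfer `B9RWSums346Schur.scaleTransfer_len_rpow` to move `(L^{j_{y′}}η)^{−p}` onto the output block inside the range `ρ`).
* §2 ★★ `blockBd_letterP_of_identities₂` ∕ ★★ `blockBd_letterC_of_identities₂` — the two letter hypotheses `hPL2` (p = 1) and `hCL2` (p = 2) of
  `factorsL2Mixed37Dir_of_letterL2_legs` from `Identities₂.hP ∕ hPt ∕ KPd_sum ∕ KPtd_sum ∕ hC ∕ hCt`, `StaticOK.KP_row ∕ KP_loc ∕ KPt_col ∕ KC_row ∕ KC_loc ∕ KCt_col`
  and the transposes `IsTransposePair (𝔩.P U i ν) (𝔩.Pt U i ν)`, `IsTransposePair (𝔬.Cop U i) (𝔬.Ct U i)`, with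
  `θ_P = √(kP·kPt·L₀)·e^{(αδ∕2+δ_L)ρ}`, `θ_C = √(kC·kCt·L₀²)·e^{(αδ∕2+δ_L)ρ}`.
* §3 ★★★ `factorsL2Mixed37Dir_of_identities₂_legs` — the COMBINED face: `StaticOK`, `Sizes.Nonneg`, `Facts347`, `Ineq261`, `Identities₂`, the two transposes and the two
  letter-free legs `hMix`, `hOne` ⊢ `FactorsL2Mixed37Dir 𝔬 𝔡 𝔩 R H θM ρ′ U`.

HONEST SCOPE.  Finite-dimensional bookkeeping (Schur's test, scale transfer, row sums) over landed modules; the majorants, kernel rows, transposes and legs are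
HYPOTHESES where used; nothing of [B9] asserted beyond kernel-checked parents; COUNT-NEUTRAL; N06 NOT discharged; nothing continuum ∕ OS ∕ mass gap ∕ Clay.
Cell `pub-ymgap` (D-0062 ∕ D-0154), Track A node N06 [B9], width seat `pub-ymgap-dag-n06-w7` (g1), 2026-08-28.  NEW file; nothing landed is modified.
-/

namespace Literature.MathematicalPhysics.QuantumFieldTheory.Balaban1983to89.B9RWSums346LetterL2FromMajorants

open Literature.MathematicalPhysics.QuantumFieldTheory.Balaban1983to89
open Finset B6RandomWalk B6RandomWalkHom B9Thm37Sum B9Thm34Ext B9Thm37Glue B9Thm37Whole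
open B9RWSums343to347Whole B9RWSums346Schur B11SectG B9SectDL2Decay B9RWSums346SecondDiffGp
open B9Thm37WholeDir B9Thm37KLetterDir B9Ineq347 B9RWSums346MixedFactorFromLegs

noncomputable section

/-! ## §1 The Schur step for a local letter -/

section Schur

variable {g : B9.Geometry} [Fintype g.Site] [DecidableEq g.Site] {R : ℝ} {H : Prop} {X : Type} [Fintype X]

/-- ★ **A LOCAL LETTER IN BLOCK-`L²` BY THE SCHUR TEST**: sup majorant `K ≧ 0` of `T` (range `ρ`, `p`-weighted entries `≦ 1_S(a)·k`), sup majorant `K′ ≧ 0` of the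
transpose `T′` (`p`-weighted entries `≦ 1_S(b)·k′`) ⇒ `‖1_{Δ(y)}Tf‖ ≦ 1_S(y)·√(k·k′·L₀^{|p|})·e^{(αδ∕2+δ_L)ρ}·(L^{j_y}η)^{−p}·e^{−δ_L d(y,y′)}·‖f‖` for `supp f ⊂ Δ(y′)`
(Cauchy–Schwarz between the row and the column bound, `B9RWSums346Schur.blockBd_schur`; the source scale `(L^{j_{y′}}η)^{−p}` is moved to `y` by the p. 398 transfer at
distance `≦ ρ`; the decay factor is free inside the range). [cite: Balaban1985BackgroundPropagators, (3.46) p.398 + remark after (3.47) p.398 + p.391; Balaban1984PropagatorsII, (2.41)–(2.44) p.230] -/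
theorem blockBd_letter_of_majorants (blk : X → g.Site) {T T' : Module.End ℝ (X → ℝ)} {K K' : g.Site → g.Site → ℝ} (S : Finset g.Site)
    {d : ℕ} {δ α L₀ k k' ρ p δL : ℝ} (hF : Facts347 g R H d δ α L₀) (hdnn : ∀ y y' : g.Site, 0 ≤ g.dist y y') (hlen : ∀ y : g.Site, 0 < g.len y)
    (hk : 0 ≤ k) (hk' : 0 ≤ k') (hδL : 0 ≤ δL) (hαδ : 0 ≤ α * δ) (hp : |p| ≤ 4)
    (hK0 : ∀ a b, 0 ≤ K a b) (hK'0 : ∀ a b, 0 ≤ K' a b) (hKloc : ∀ a b, K a b ≠ 0 → g.dist a b ≤ ρ)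
    (hKrow : ∀ a b, a ∈ S → K a b * g.len b ^ p ≤ k) (hKoff : ∀ a b, a ∉ S → K a b = 0) (hK'col : ∀ a b, b ∈ S → K' a b * g.len b ^ p ≤ k')
    (hT : HasMajorant (g := toB6 g R H) blk T K) (hT' : HasMajorant (g := toB6 g R H) blk T' K') (htr : IsTransposePair T T') :
    BlockBd (g := toB6 g R H) blk blk T
      (fun (y y' : g.Site) => (if y ∈ S then (1 : ℝ) else 0) * (Real.sqrt (k * k' * L₀ ^ |p|) * Real.exp ((α * δ / 2 + δL) * ρ) * g.len y ^ (-p)) *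
        Real.exp (-(δL * g.dist y y'))) := by
  have hlen0 : ∀ y : g.Site, 0 ≤ g.len y := fun y => (hlen y).le
  have hL0 : 0 ≤ g.L := zero_le_one.trans hF.one_le_L
  have hL₀ : 0 ≤ L₀ := hL0.trans hF.L_le
  have hsch := blockBd_schur (G := toB6 g R H) blk blk hK0 hK'0 ((hasMajorantHom_iff _ _ _).mpr hT) ((hasMajorantHom_iff _ _ _).mpr hT') htr
  refine hsch.mono fun (y : g.Site) (y' : g.Site) => ?_
  show Real.sqrt (K y y' * K' y' y) ≤ (if y ∈ S then (1 : ℝ) else 0) *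
    (Real.sqrt (k * k' * L₀ ^ |p|) * Real.exp ((α * δ / 2 + δL) * ρ) * g.len y ^ (-p)) * Real.exp (-(δL * g.dist y y'))
  by_cases hyS : y ∈ S
  swap
  · rw [hKoff y y' hyS, zero_mul, Real.sqrt_zero, if_neg hyS, zero_mul, zero_mul]
  rw [if_pos hyS, one_mul]
  set Xv : ℝ := (Real.sqrt (k * k' * L₀ ^ |p|) * Real.exp ((α * δ / 2 + δL) * ρ) * g.len y ^ (-p)) * Real.exp (-(δL * g.dist y y')) with hXv
  have hX0 : 0 ≤ Xv := mul_nonneg (mul_nonneg (mul_nonneg (Real.sqrt_nonneg _) (Real.exp_nonneg _)) (Real.rpow_nonneg (hlen0 y) _)) (Real.exp_nonneg _)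
  by_cases hKz : K y y' = 0
  · rw [hKz, zero_mul, Real.sqrt_zero]; exact hX0
  -- inside the range: d(y,y′) ≤ ρ
  have hd : g.dist y y' ≤ ρ := hKloc y y' hKz
  have hrow : K y y' * g.len y' ^ p ≤ k := hKrow y y' hyS
  have hcol : K' y' y * g.len y ^ p ≤ k' := hK'col y' y hyS
  -- pointwise: K ≤ k·(L^{j_{y′}}η)^{−p}, K′ ≤ k′·(L^{j_y}η)^{−p}
  have hKle : K y y' ≤ k * g.len y' ^ (-p) := by
    rw [Real.rpow_neg (hlen0 y'), ← div_eq_mul_inv, le_div_iff₀ (Real.rpow_pos_of_pos (hlen y') p)]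
    exact hrow
  have hK'le : K' y' y ≤ k' * g.len y ^ (-p) := by
    rw [Real.rpow_neg (hlen0 y), ← div_eq_mul_inv, le_div_iff₀ (Real.rpow_pos_of_pos (hlen y) p)]
    exact hcol
  -- the transfer of the source scale to the output block at distance ≤ ρ
  have htransfer : g.len y' ^ (-p) ≤ L₀ ^ |p| * Real.exp (α * δ * ρ) * g.len y ^ (-p) := by
    have hst : Real.exp (-(α * δ * g.dist y y')) * g.len y' ^ (-p) ≤ g.L ^ |(-p)| * g.len y ^ (-p) :=
      scaleTransfer_len_rpow hF (-p) (by rw [abs_neg]; exact hp) y y'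
    rw [abs_neg] at hst
    have h1 : g.len y' ^ (-p) ≤ Real.exp (α * δ * g.dist y y') * (g.L ^ |p| * g.len y ^ (-p)) := by
      have h := mul_le_mul_of_nonneg_left hst (Real.exp_nonneg (α * δ * g.dist y y'))
      rwa [← mul_assoc, ← Real.exp_add, show α * δ * g.dist y y' + -(α * δ * g.dist y y') = 0 by ring, Real.exp_zero, one_mul] at h
    have h2 : Real.exp (α * δ * g.dist y y') ≤ Real.exp (α * δ * ρ) := Real.exp_le_exp.mpr (mul_le_mul_of_nonneg_left hd hαδ)
    have h3 : g.L ^ |p| ≤ L₀ ^ |p| := Real.rpow_le_rpow hL0 hF.L_le (abs_nonneg p)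
    calc g.len y' ^ (-p) ≤ Real.exp (α * δ * g.dist y y') * (g.L ^ |p| * g.len y ^ (-p)) := h1
      _ ≤ Real.exp (α * δ * ρ) * (L₀ ^ |p| * g.len y ^ (-p)) :=
          mul_le_mul h2 (mul_le_mul_of_nonneg_right h3 (Real.rpow_nonneg (hlen0 y) _)) (mul_nonneg (Real.rpow_nonneg hL0 _) (Real.rpow_nonneg (hlen0 y) _))
            (Real.exp_nonneg _)
      _ = L₀ ^ |p| * Real.exp (α * δ * ρ) * g.len y ^ (-p) := by ring
  -- the product of the two sup kernels against the square of the target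
  have hlp : 0 ≤ g.len y ^ (-p) := Real.rpow_nonneg (hlen0 y) _
  have hprod : K y y' * K' y' y ≤ (k * (L₀ ^ |p| * Real.exp (α * δ * ρ) * g.len y ^ (-p))) * (k' * g.len y ^ (-p)) :=
    mul_le_mul (hKle.trans (mul_le_mul_of_nonneg_left htransfer hk)) hK'le (hK'0 y' y)
      (mul_nonneg hk (mul_nonneg (mul_nonneg (Real.rpow_nonneg hL₀ _) (Real.exp_nonneg _)) hlp))
  have hd0 : 0 ≤ g.dist y y' := hdnn y y'
  have hdecay : Real.exp (α * δ * ρ) ≤ Real.exp ((α * δ / 2 + δL) * ρ) ^ 2 * Real.exp (-(δL * g.dist y y')) ^ 2 := by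
    rw [← Real.exp_nat_mul, ← Real.exp_nat_mul, ← Real.exp_add]
    exact Real.exp_le_exp.mpr (by push_cast; nlinarith [hd, hδL, hd0])
  have hsq : K y y' * K' y' y ≤ Xv ^ 2 := by
    have hm : 0 ≤ k * k' * L₀ ^ |p| := mul_nonneg (mul_nonneg hk hk') (Real.rpow_nonneg hL₀ _)
    have hXsq : Xv ^ 2 = (k * k' * L₀ ^ |p|) * (Real.exp ((α * δ / 2 + δL) * ρ) ^ 2 * Real.exp (-(δL * g.dist y y')) ^ 2) * (g.len y ^ (-p)) ^ 2 := by
      rw [hXv, mul_pow, mul_pow, mul_pow, Real.sq_sqrt hm]; ring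
    rw [hXsq]
    calc K y y' * K' y' y ≤ (k * (L₀ ^ |p| * Real.exp (α * δ * ρ) * g.len y ^ (-p))) * (k' * g.len y ^ (-p)) := hprod
      _ = (k * k' * L₀ ^ |p|) * Real.exp (α * δ * ρ) * (g.len y ^ (-p)) ^ 2 := by ring
      _ ≤ (k * k' * L₀ ^ |p|) * (Real.exp ((α * δ / 2 + δL) * ρ) ^ 2 * Real.exp (-(δL * g.dist y y')) ^ 2) * (g.len y ^ (-p)) ^ 2 :=
          mul_le_mul_of_nonneg_right (mul_le_mul_of_nonneg_left hdecay hm) (sq_nonneg _)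
  calc Real.sqrt (K y y' * K' y' y) ≤ Real.sqrt (Xv ^ 2) := Real.sqrt_le_sqrt hsq
    _ = Xv := Real.sqrt_sq hX0

end Schur

/-! ## §2 The letters `P_{□,ν}` and `C_□` of `K(h_□)` at the displayed data of the certificate -/

section Letters

variable {g : B9.Geometry} [Fintype g.Site] [DecidableEq g.Site] {R : ℝ} {H : Prop} {B : B9.Backgrounds}
variable {X Y ι Dir : Type} [Fintype ι] [Fintype Dir]

/-- ★★ **THE LETTER `P_{□,ν}` IN BLOCK-`L²`** from `Identities₂` (`hP`, `hPt`, `KPd_sum`, `KPtd_sum`, nonnegativity), `StaticOK` (`KP_row`, `KP_loc`, `KPt_col`) and the transpose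
`IsTransposePair (𝔩.P U i ν) (𝔩.Pt U i ν)`: `‖1_{Δ(y)}P_{□,ν}f‖ ≦ 1_{S′_□}(y)·θ_P·(L^{j_y}η)⁻¹·e^{−δ_L d(y,y′)}‖f‖`, `θ_P = √(kP·kPt·L₀)·e^{(αδ∕2+δ_L)ρ}` — the
hypothesis `hPL2` of `factorsL2Mixed37Dir_of_letterL2_legs`. [cite: Balaban1985BackgroundPropagators, (3.88) p.409 + p.391; Balaban1984PropagatorsII, (2.39)–(2.44) pp.229–230] -/
theorem blockBd_letterP_of_identities₂ [Fintype X] [Fintype Y] (𝔬 : Ops g B X Y ι) (𝔡 : DirOps37 𝔬 Dir) (𝔩 : DirLetters37 𝔬 Dir) (R : ℝ) (H : Prop)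
    {d : ℕ} {δ α L₀ ρ N N' Cℓ δL : ℝ} {κ : Sizes} (U : B.Cfg) (hs : StaticOK 𝔬 ρ N N' Cℓ κ) (hκ : κ.Nonneg) (hF : Facts347 g R H d δ α L₀)
    (hi : Identities₂ 𝔬 𝔡 𝔩 R H U) (hδL : 0 ≤ δL) (hαδ : 0 ≤ α * δ) (i : ι) (ν : Dir) (hPt : IsTransposePair (𝔩.P U i ν) (𝔩.Pt U i ν)) :
    BlockBd (g := toB6 g R H) 𝔬.blk 𝔬.blk (𝔩.P U i ν)
      (fun (y y' : g.Site) => (if y ∈ 𝔬.S' i then (1 : ℝ) else 0) *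
        ((Real.sqrt (κ.kP * κ.kPt * L₀ ^ |(1 : ℝ)|) * Real.exp ((α * δ / 2 + δL) * ρ)) * g.len y ^ (-1 : ℝ)) * Real.exp (-(δL * g.dist y y'))) := by
  have hlen0 : ∀ y : g.Site, 0 ≤ g.len y := fun y => (hs.lenpos y).le
  have hKle : ∀ a b, 𝔩.KPd i ν a b ≤ 𝔬.KP i a b := fun a b =>
    (Finset.single_le_sum (f := fun μ => 𝔩.KPd i μ a b) (fun μ _ => hi.KPd_nonneg i μ a b) (Finset.mem_univ ν)).trans (hi.KPd_sum i a b)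
  have hK'le : ∀ a b, 𝔩.KPtd i ν a b ≤ 𝔬.KPt i a b := fun a b =>
    (Finset.single_le_sum (f := fun μ => 𝔩.KPtd i μ a b) (fun μ _ => hi.KPtd_nonneg i μ a b) (Finset.mem_univ ν)).trans (hi.KPtd_sum i a b)
  have hrowKP : ∀ a b : g.Site, 𝔬.KP i a b * g.len b ≤ if a ∈ 𝔬.S' i then κ.kP else 0 := fun a b =>
    (Finset.single_le_sum (f := fun y'' => 𝔬.KP i a y'' * g.len y'') (fun y'' _ => mul_nonneg (hs.KP_nonneg i a y'') (hlen0 y'')) (Finset.mem_univ b)).trans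
      (hs.KP_row i a)
  have h := blockBd_letter_of_majorants (R := R) (H := H) 𝔬.blk (𝔬.S' i) (p := (1 : ℝ)) hF hs.dnn hs.lenpos hκ.kP hκ.kPt hδL hαδ (by rw [abs_one]; norm_num)
    (fun a b => hi.KPd_nonneg i ν a b) (fun a b => hi.KPtd_nonneg i ν a b)
    (fun a b hab => hs.KP_loc i a b (fun h0 => hab (le_antisymm (h0 ▸ hKle a b) (hi.KPd_nonneg i ν a b))))
    (fun a b ha => by
      have hr := hrowKP a b
      rw [if_pos ha] at hr
      rw [Real.rpow_one]
      exact (mul_le_mul_of_nonneg_right (hKle a b) (hlen0 b)).trans hr)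
    (fun a b ha => by
      have hr := hrowKP a b
      rw [if_neg ha] at hr
      have hKP : 𝔬.KP i a b ≤ 0 := by
        by_contra hpos
        push Not at hpos
        have : 0 < 𝔬.KP i a b * g.len b := mul_pos hpos (hs.lenpos b)
        linarith
      exact le_antisymm ((hKle a b).trans hKP) (hi.KPd_nonneg i ν a b))
    (fun a b hb => by
      have hc := hs.KPt_col i b
      rw [if_pos hb] at hc
      have hsingle : 𝔬.KPt i a b ≤ ∑ y'' : g.Site, 𝔬.KPt i y'' b :=
        Finset.single_le_sum (f := fun y'' => 𝔬.KPt i y'' b) (fun y'' _ => hs.KPt_nonneg i y'' b) (Finset.mem_univ a)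
      rw [Real.rpow_one]
      exact (mul_le_mul_of_nonneg_right ((hK'le a b).trans hsingle) (hlen0 b)).trans hc)
    (hi.hP i ν) (hi.hPt i ν) hPt
  exact h.mono fun y y' => le_of_eq (by ring)

/-- ★★ **THE LETTER `C_□` IN BLOCK-`L²`** from `Identities₂` (`hC`, `hCt`), `StaticOK` (`KC_row`, `KC_loc`, `KCt_col`) and the transpose `IsTransposePair (𝔬.Cop U i) (𝔬.Ct U i)`:
`‖1_{Δ(y)}C_□f‖ ≦ 1_{S′_□}(y)·θ_C·(L^{j_y}η)⁻²·e^{−δ_L d(y,y′)}‖f‖`, `θ_C = √(kC·kCt·L₀²)·e^{(αδ∕2+δ_L)ρ}` — the hypothesis `hCL2` of `factorsL2Mixed37Dir_of_letterL2_legs`.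
[cite: Balaban1985BackgroundPropagators, (3.88) p.409 + p.391; Balaban1984PropagatorsII, (2.39)–(2.44) pp.229–230] -/
theorem blockBd_letterC_of_identities₂ [Fintype X] [Fintype Y] (𝔬 : Ops g B X Y ι) (𝔡 : DirOps37 𝔬 Dir) (𝔩 : DirLetters37 𝔬 Dir) (R : ℝ) (H : Prop)
    {d : ℕ} {δ α L₀ ρ N N' Cℓ δL : ℝ} {κ : Sizes} (U : B.Cfg) (hs : StaticOK 𝔬 ρ N N' Cℓ κ) (hκ : κ.Nonneg) (hF : Facts347 g R H d δ α L₀)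
    (hi : Identities₂ 𝔬 𝔡 𝔩 R H U) (hδL : 0 ≤ δL) (hαδ : 0 ≤ α * δ) (i : ι) (hCt : IsTransposePair (𝔬.Cop U i) (𝔬.Ct U i)) :
    BlockBd (g := toB6 g R H) 𝔬.blk 𝔬.blk (𝔬.Cop U i)
      (fun (y y' : g.Site) => (if y ∈ 𝔬.S' i then (1 : ℝ) else 0) *
        ((Real.sqrt (κ.kC * κ.kCt * L₀ ^ |(2 : ℝ)|) * Real.exp ((α * δ / 2 + δL) * ρ)) * g.len y ^ (-2 : ℝ)) * Real.exp (-(δL * g.dist y y'))) := by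
  have hlen0 : ∀ y : g.Site, 0 ≤ g.len y := fun y => (hs.lenpos y).le
  have h2 : ∀ b : g.Site, g.len b ^ (2 : ℝ) = g.len b ^ 2 := fun b => Real.rpow_two (g.len b)
  have hrowKC : ∀ a b : g.Site, 𝔬.KC i a b * g.len b ^ 2 ≤ if a ∈ 𝔬.S' i then κ.kC else 0 := fun a b =>
    (Finset.single_le_sum (f := fun y'' => 𝔬.KC i a y'' * g.len y'' ^ 2) (fun y'' _ => mul_nonneg (hs.KC_nonneg i a y'') (sq_nonneg _)) (Finset.mem_univ b)).trans
      (hs.KC_row i a)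
  have h := blockBd_letter_of_majorants (R := R) (H := H) 𝔬.blk (𝔬.S' i) (p := (2 : ℝ)) hF hs.dnn hs.lenpos hκ.kC hκ.kCt hδL hαδ (by rw [abs_two]; norm_num)
    (fun a b => hs.KC_nonneg i a b) (fun a b => hs.KCt_nonneg i a b) (fun a b hab => hs.KC_loc i a b hab)
    (fun a b ha => by
      have hr := hrowKC a b
      rw [if_pos ha] at hr
      rw [h2]
      exact hr)
    (fun a b ha => by
      have hr := hrowKC a b
      rw [if_neg ha] at hr
      have hKC : 𝔬.KC i a b ≤ 0 := by
        by_contra hpos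
        push Not at hpos
        have : 0 < 𝔬.KC i a b * g.len b ^ 2 := mul_pos hpos (pow_pos (hs.lenpos b) 2)
        linarith
      exact le_antisymm hKC (hs.KC_nonneg i a b))
    (fun a b hb => by
      have hc := hs.KCt_col i b
      rw [if_pos hb] at hc
      have hsingle : 𝔬.KCt i a b ≤ ∑ y'' : g.Site, 𝔬.KCt i y'' b :=
        Finset.single_le_sum (f := fun y'' => 𝔬.KCt i y'' b) (fun y'' _ => hs.KCt_nonneg i y'' b) (Finset.mem_univ a)
      rw [h2]
      exact (mul_le_mul_of_nonneg_right hsingle (sq_nonneg _)).trans hc)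
    (hi.hC i) (hi.hCt i) hCt
  exact h.mono fun y y' => le_of_eq (by ring)

end Letters

/-! ## §3 The combined face: `FactorsL2Mixed37Dir` from the displayed data, two transposes and two legs -/

section Combined

variable {g : B9.Geometry} [Fintype g.Site] [DecidableEq g.Site] {R : ℝ} {H : Prop} {B : B9.Backgrounds}
variable {X Y ι Dir : Type} [Fintype ι] [Fintype Dir]

/-- ★★★ **ROWS 18's `FactorsL2Mixed37Dir` FROM THE CERTIFICATE'S DISPLAYED DATA + TWO LETTER TRANSPOSES + TWO LETTER-FREE LEGS**: `StaticOK`, `Sizes.Nonneg`, `Facts347`,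
`Ineq261 d₁ δ₁ α₁`, `Identities₂`, the transposes `Pᵗ_{□,ν} = (P_{□,ν})ᵗ`, `Cᵗ_□ = (C_□)ᵗ` in the component pairing, the UNCUT MIXED LEG `∇_νG′_□M_{h_□}∇\*_μ` (bound
`B_M·e^{−δ₁d}`) and the FIRST-ORDER LEG `G′_□M_{h_□}∇\*_μ` (bound `B₁·(L^{j_y}η)·e^{−δ₁d}`) give `FactorsL2Mixed37Dir 𝔬 𝔡 𝔩 R H θM ρ′ U` with
`θM = (|Dir|·θ_P·B_M + θ_C·B₁·L₀)·c₁(d₁,δ₁,α₁)`, `θ_P = √(kP·kPt·L₀)·e^{(αδ∕2+αδ+ρ′)ρ}`, `θ_C = √(kC·kCt·L₀²)·e^{(αδ∕2+αδ+ρ′)ρ}` (letters read at the rate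
`δ_L := αδ + ρ′`), for `0 ≦ ρ′ ≦ (1 − α₁)δ₁`, `0 ≦ αδ`. [cite: Balaban1985BackgroundPropagators, (3.88)–(3.89) p.409 + (3.46) p.398 + p.391; Balaban1984PropagatorsII, (2.39)–(2.44) pp.229–230 + (2.52)–(2.55) p.232 + Lemma 2.1 (2.61) p.234] -/
theorem factorsL2Mixed37Dir_of_identities₂_legs [Fintype X] [Fintype Y] (𝔬 : Ops g B X Y ι) (𝔡 : DirOps37 𝔬 Dir) (𝔩 : DirLetters37 𝔬 Dir)
    (R : ℝ) (H : Prop) (d d₁ : ℕ) (δ α L₀ δ₁ α₁ ρ N N' Cℓ ρ' BM B1 : ℝ) (κ : Sizes) (U : B.Cfg)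
    (hBM : 0 ≤ BM) (hB1 : 0 ≤ B1) (hρ' : 0 ≤ ρ') (hrate : ρ' ≤ (1 - α₁) * δ₁) (hαδ : 0 ≤ α * δ)
    (hs : StaticOK 𝔬 ρ N N' Cℓ κ) (hκ : κ.Nonneg) (h261 : Ineq261 d₁ (toB6 g R H) δ₁ α₁) (hF : Facts347 g R H d δ α L₀) (hi : Identities₂ 𝔬 𝔡 𝔩 R H U)
    (hPt : ∀ (i : ι) (ν : Dir), IsTransposePair (𝔩.P U i ν) (𝔩.Pt U i ν)) (hCt : ∀ i : ι, IsTransposePair (𝔬.Cop U i) (𝔬.Ct U i))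
    (hMix : ∀ (i : ι) (ν μ : Dir), BlockBd (g := toB6 g R H) 𝔬.blk 𝔬.blk (𝔡.Dd U ν ∘ₗ ((𝔬.Gsq U i * mulOp (𝔬.h i)) ∘ₗ 𝔡.Dsd U μ))
      (fun (y y' : g.Site) => BM * Real.exp (-(δ₁ * g.dist y y'))))
    (hOne : ∀ (i : ι) (μ : Dir), BlockBd (g := toB6 g R H) 𝔬.blk 𝔬.blk ((𝔬.Gsq U i * mulOp (𝔬.h i)) ∘ₗ 𝔡.Dsd U μ)
      (fun (y y' : g.Site) => B1 * g.len y ^ (1 : ℝ) * Real.exp (-(δ₁ * g.dist y y')))) :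
    FactorsL2Mixed37Dir 𝔬 𝔡 𝔩 R H
      (((Fintype.card Dir : ℝ) * ((Real.sqrt (κ.kP * κ.kPt * L₀ ^ |(1 : ℝ)|) * Real.exp ((α * δ / 2 + (α * δ + ρ')) * ρ)) * BM) +
          (Real.sqrt (κ.kC * κ.kCt * L₀ ^ |(2 : ℝ)|) * Real.exp ((α * δ / 2 + (α * δ + ρ')) * ρ)) * (B1 * L₀)) * B6.c1 d₁ δ₁ α₁) ρ' U := by
  have hδL : 0 ≤ α * δ + ρ' := add_nonneg hαδ hρ'
  exact factorsL2Mixed37Dir_of_letterL2_legs 𝔬 𝔡 𝔩 R H d d₁ δ α L₀ δ₁ α₁ ρ N N' Cℓ (α * δ + ρ') ρ' _ _ BM B1 κ U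
    (mul_nonneg (Real.sqrt_nonneg _) (Real.exp_nonneg _)) (mul_nonneg (Real.sqrt_nonneg _) (Real.exp_nonneg _)) hBM hB1 hρ' hrate le_rfl hs h261 hF
    (fun i ν => blockBd_letterP_of_identities₂ 𝔬 𝔡 𝔩 R H U hs hκ hF hi hδL hαδ i ν (hPt i ν))
    (fun i => blockBd_letterC_of_identities₂ 𝔬 𝔡 𝔩 R H U hs hκ hF hi hδL hαδ i (hCt i)) hMix hOne

end Combined

end

end Literature.MathematicalPhysics.QuantumFieldTheory.Balaban1983to89.B9RWSums346LetterL2FromMajorants
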